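import Literature.Probability.RandomPlanarGeometry.SLEMarkovKernelFunctional
import Literature.Probability.RandomPlanarGeometry.LoewnerDescriptionProofs
import HarnessLib

/-!
# The domain-Markov kernel of chordal SLE_κ: the test functional of the freezing formula

Topic `Probability/RandomPlanarGeometry`; theorems and definitions (companion of
`SLEMarkovKernel.lean`, crux `stmt-CriticalPhenomena-0698`, stub `stub_isDomainMarkov`).

The `markov` clause is obtained from the strong Markov property of the SLE trace at the hitting
time `τ` of `A = Φp⁻¹ F` (freezing formula of `SLETraceHittingMarkov`) applied to the bounded
jointly measurable test functional
`markovFz φ S T (W^τ, τ) γ' = 𝟙[pastX (W^τ, τ) ∈ S ∧ compactifiedClass (psiTilde Φp W^τ τ) b γ' ∈ T]`.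
This file defines it and identifies, for a described sample, (L) its value at the after-path
`γ^τ` with the indicator of the surgery event `{stopAt F ∈ S, startFrom F ∈ T}`
(`markovFz_eq_of_hit`, through `γ(τ+u) = f̄_τ(γ^τ(u) + W τ)` and the final-segment surgery of
`StoppedCompactifiedImage`), and (R) its frozen integral against a fresh trace with the read-off
kernel value `gval` (`integral_markovFz_sleTrace_eq`, `gval_eq_of_traceHitTime_eq`).

References: W. Werner (2007), §3.2; G. F. Lawler (2005), §6.2–6.3; S. Rohde, O. Schramm (2005), §7.
-/

noncomputable section

open Set Filter Topology MeasureTheory ProbabilityTheory Complex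
open UpperHalfPlane (upperHalfPlaneSet isOpen_upperHalfPlaneSet)
open scoped NNReal ENNReal unitInterval

namespace Literature.Probability.RandomPlanarGeometry

/-! ### Identification of the test functional on described samples -/

section MarkovIdentify

open scoped PathBorel

variable {κ : ℝ≥0} {D : DobrushinDomain} {φ : ConformalEquiv upperHalfPlaneSet D.carrier}
  (hφ : D.IsChordalUniformizing φ) {W : ℝ≥0 → ℝ} (hW : Continuous W) {γ : ℝ≥0 → ℂ}
  (hγ : Loewner.IsGeneratedByCurve W γ) (htr : Tendsto (fun t ↦ ‖γ t‖) atTop atTop)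

/-! #### The final segment of the full curve as the image of the shifted trace -/

include htr in
/-- The shifted trace is transient. [folklore] -/
theorem tendsto_norm_shift (r : ℝ≥0) : Tendsto (fun s ↦ ‖γ (r + s)‖) atTop atTop :=
  htr.comp (tendsto_atTop_mono (fun _ ↦ le_add_self) tendsto_id)

include hφ hγ htr in
/-- The compactified image of the shifted trace is a continuous curve. [folklore] -/
theorem continuous_nodeValue_shift (r : ℝ≥0) :
    Continuous (nodeValue φ.boundaryExtension (D.pt 1) fun s ↦ γ (r + s)) :=
  continuous_nodeValue
    ((JordanDomain.continuousOn_boundaryExtension_holds D.toJordanDomain φ).mono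
      (by rw [ConformalEquiv.closure_upperHalfPlaneSet_eq]))
    (MarkedDomain.IsChordalUniformizing.tendsto_boundaryExtension_cocompact hφ)
    (hγ.continuous.comp (continuous_const.add continuous_id)) (fun s ↦ hγ.im_nonneg _)
    (tendsto_cocompact_of_tendsto_norm_atTop (tendsto_norm_shift htr r))

/-- **The shifted curve**: the compactified image of `s ↦ γ (r + s)`. [folklore] -/
def shiftCurve (hφ : D.IsChordalUniformizing φ) (hγ : Loewner.IsGeneratedByCurve W γ)
    (htr : Tendsto (fun t ↦ ‖γ t‖) atTop atTop) (r : ℝ≥0) : Curve ℂ :=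
  ⟨⟨nodeValue φ.boundaryExtension (D.pt 1) fun s ↦ γ (r + s), continuous_nodeValue_shift hφ hγ htr r⟩⟩

/-- The shifted curve is the compactified image of the shifted trace. [folklore] -/
theorem isCompactifiedImage_shiftCurve (r : ℝ≥0) :
    IsCompactifiedImage φ.boundaryExtension (fun s ↦ γ (r + s)) (D.pt 1) (shiftCurve hφ hγ htr r) :=
  isCompactifiedImage_nodeValue _ _ _ _

variable {F : Set ℂ}

/-- **The final segment at a hit** is the class of the shifted curve. [cite: Werner2007, §3.2] -/
theorem startFrom_fullCurve_of_hit (hF : IsClosed F) {r : ℝ≥0}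
    (hr : φ.boundaryExtension (γ r) ∈ F) (hbefore : ∀ s < r, φ.boundaryExtension (γ s) ∉ F) :
    CurveClass.startFrom F (CurveClass.mk (fullCurve hφ hγ htr)) =
      CurveClass.mk (shiftCurve hφ hγ htr r) :=
  CurveClass.startFrom_mk_eq_of_isCompactifiedImage (isCompactifiedImage_fullCurve hφ hγ htr) hF hr
    hbefore (isCompactifiedImage_shiftCurve hφ hγ htr r)

/-- **The shifted curve is the image of the "after" path under `ψ`** when the trace after `r`
is `f̄_r (γa + W r)`. [cite: Lawler2005, §6.2] -/
theorem isCompactifiedImage_ψ_of_shift {r : ℝ≥0} {γa : ℝ≥0 → ℂ} (hγa : ∀ u, 0 ≤ (γa u).im)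
    (hshift : ∀ u, γ (r + u) = Loewner.bdryInv W r (γa u + W r)) :
    IsCompactifiedImage (mkConfig hφ hW hγ r).ψ γa (D.pt 1) (shiftCurve hφ hγ htr r) := by
  refine ⟨fun s hs ↦ ?_, (isCompactifiedImage_shiftCurve hφ hγ htr r).2⟩
  rw [(isCompactifiedImage_shiftCurve hφ hγ htr r).1 s hs, SLEConfig.ψ_apply_of_im_nonneg _ (hγa _)]
  change φ.boundaryExtension (γ (r + rayParam s)) = _
  rw [hshift]
  rfl

/-- **The image class of the "after" path under `ψ` is the final segment.** [cite: Werner2007, §3.2] -/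
theorem compactifiedClass_ψ_eq_startFrom (hF : IsClosed F) {r : ℝ≥0}
    (hr : φ.boundaryExtension (γ r) ∈ F) (hbefore : ∀ s < r, φ.boundaryExtension (γ s) ∉ F)
    {γa : ℝ≥0 → ℂ} (hγa : ∀ u, 0 ≤ (γa u).im)
    (hshift : ∀ u, γ (r + u) = Loewner.bdryInv W r (γa u + W r)) :
    compactifiedClass (mkConfig hφ hW hγ r).ψ (D.pt 1) γa =
      CurveClass.startFrom F (CurveClass.mk (fullCurve hφ hγ htr)) := by
  rw [startFrom_fullCurve_of_hit hφ hγ htr hF hr hbefore]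
  exact (isCompactifiedImage_ψ_of_shift hφ hW hγ htr hγa hshift).compactifiedClass_eq

/-! #### Identification of the test functional and of its frozen integral -/

include hW in
/-- **(L)** At a hit, the test functional evaluated at (stopped driver datum, after-path) is
the indicator of the surgery event. [cite: Werner2007, §3.2] -/
theorem markovFz_eq_of_hit (hF : IsClosed F) {r : ℝ≥0}
    (hr : φ.boundaryExtension (γ r) ∈ F) (hbefore : ∀ s < r, φ.boundaryExtension (γ s) ∉ F)
    {γa : ℝ≥0 → ℂ} (hγa : ∀ u, 0 ≤ (γa u).im)
    (hshift : ∀ u, γ (r + u) = Loewner.bdryInv W r (γa u + W r))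
    {x : C(ℝ≥0, ℝ) × WithTop ℝ≥0} (hx2 : x.2 = r) (hx1 : ∀ s, s ≤ r → x.1 s = W s)
    (S T : Set (CurveClass ℂ)) {c : CurveClass ℂ} (hc : c = CurveClass.mk (fullCurve hφ hγ htr)) :
    markovFz φ S T x γa =
      (CurveClass.stopAt F ⁻¹' S ∩ CurveClass.startFrom F ⁻¹' T).indicator (fun _ ↦ (1 : ℝ)) c := by
  classical
  obtain ⟨U, r'⟩ := x
  have hx2' : r' = (r : WithTop ℝ≥0) := hx2
  subst hx2'
  have hU : ∀ s, s ≤ r → U s = (⟨W, hW⟩ : C(ℝ≥0, ℝ)) s := hx1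
  have hpast : pastX φ (U, ((r : ℝ≥0) : WithTop ℝ≥0)) = CurveClass.stopAt F c := by
    rw [pastX_congr hU, pastX_eq_mk_stoppedCurve hφ hW hγ r, hc,
      stopAt_fullCurve_of_hit hφ hγ htr hF hr hbefore]
  have hψ : psiTilde (Φp φ) U r = (mkConfig hφ hW hγ r).ψ := by
    rw [psiTilde_congr_driver hU]
    exact funext (psiTilde_eq_config_ψ hφ hW hγ r)
  have hfut : compactifiedClass (psiTilde (Φp φ) U r) (D.pt 1) γa = CurveClass.startFrom F c := by
    rw [hψ, hc]
    exact compactifiedClass_ψ_eq_startFrom hφ hW hγ htr hF hr hbefore hγa hshift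
  unfold markovFz
  simp only [WithTop.untopD_coe]
  rw [hpast, hfut]
  simp only [indicator_apply, mem_prod, mem_inter_iff, mem_preimage]

/-- **(R)** The frozen integral of the test functional against a fresh SLE trace is
`𝟙[stopped class ∈ S] · (image law of the configuration)(T)`. [cite: Werner2007, §3.2] -/
theorem integral_markovFz_sleTrace_eq (h0 : HasSLETrace κ) {r : ℝ≥0}
    {x : C(ℝ≥0, ℝ) × WithTop ℝ≥0} (hx2 : x.2 = r) (hx1 : ∀ s, s ≤ r → x.1 s = W s)
    (S : Set (CurveClass ℂ)) {T : Set (CurveClass ℂ)} (hT : MeasurableSet T) :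
    ∫ ω', markovFz φ S T x (sleTrace κ ω') ∂Process.preWienerMeasure =
      (S.indicator (fun _ ↦ (1 : ℝ≥0∞)) (CurveClass.mk (stoppedCurve φ hγ r)) *
        sleImageLaw κ (mkConfig hφ hW hγ r).ψ (D.pt 1) T).toReal := by
  classical
  obtain ⟨U, r'⟩ := x
  have hx2' : r' = (r : WithTop ℝ≥0) := hx2
  subst hx2'
  have hU : ∀ s, s ≤ r → U s = (⟨W, hW⟩ : C(ℝ≥0, ℝ)) s := hx1
  have hpast : pastX φ (U, ((r : ℝ≥0) : WithTop ℝ≥0)) = CurveClass.mk (stoppedCurve φ hγ r) := by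
    rw [pastX_congr hU, pastX_eq_mk_stoppedCurve hφ hW hγ r]
  have hψ : psiTilde (Φp φ) U r = (mkConfig hφ hW hγ r).ψ := by
    rw [psiTilde_congr_driver hU]
    exact funext (psiTilde_eq_config_ψ hφ hW hγ r)
  set c := mkConfig hφ hW hγ r with hcdef
  unfold markovFz
  simp only [WithTop.untopD_coe]
  rw [hpast, hψ]
  by_cases hS : CurveClass.mk (stoppedCurve φ hγ r) ∈ S
  · have hint : ∀ ω', (S ×ˢ T).indicator (fun _ ↦ (1 : ℝ))
          (CurveClass.mk (stoppedCurve φ hγ r), compactifiedClass c.ψ (D.pt 1) (sleTrace κ ω')) =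
        T.indicator (1 : CurveClass ℂ → ℝ) (compactifiedClass c.ψ (D.pt 1) (sleTrace κ ω')) := by
      intro ω'
      by_cases hT' : compactifiedClass c.ψ (D.pt 1) (sleTrace κ ω') ∈ T
      · rw [indicator_of_mem (mem_prod.2 ⟨hS, hT'⟩), indicator_of_mem hT', Pi.one_apply]
      · rw [indicator_of_notMem (fun h ↦ hT' (mem_prod.1 h).2), indicator_of_notMem hT']
    simp only [hint]
    have hf : AEMeasurable (fun ω' ↦ compactifiedClass c.ψ (D.pt 1) (sleTrace κ ω'))
        Process.preWienerMeasure :=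
      (measurable_compactifiedClass c.measurable_ψ _).comp_aemeasurable (aemeasurable_sleTrace_pi h0)
    have hmap := integral_map hf (f := T.indicator (1 : CurveClass ℂ → ℝ))
      (measurable_const.indicator hT).aestronglyMeasurable
    rw [← hmap]
    change ∫ y, T.indicator (1 : CurveClass ℂ → ℝ) y ∂(sleImageLaw κ c.ψ (D.pt 1)) = _
    rw [integral_indicator_one hT]
    simp only [indicator_of_mem hS, one_mul, measureReal_def]
  · have hint : ∀ ω', (S ×ˢ T).indicator (fun _ ↦ (1 : ℝ))
          (CurveClass.mk (stoppedCurve φ hγ r), compactifiedClass c.ψ (D.pt 1) (sleTrace κ ω')) = 0 :=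
      fun ω' ↦ indicator_of_notMem (fun h ↦ hS (mem_prod.1 h).1) _
    simp only [hint, integral_zero, indicator_of_notMem hS, zero_mul, ENNReal.toReal_zero]

/-- **`gval` at a finite hitting time**, for a class whose driving function is `W`. [folklore] -/
theorem gval_eq_of_traceHitTime_eq {c : CurveClass ℂ} (heqW : drivingFunction φ c = W)
    (S T : Set (CurveClass ℂ)) {r : ℝ≥0}
    (hτ : traceHitTime φ (Φp φ ⁻¹' F) c = r) :
    gval κ φ F S T c = S.indicator (fun _ ↦ (1 : ℝ≥0∞)) (CurveClass.mk (stoppedCurve φ hγ r)) *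
      sleImageLaw κ (mkConfig hφ hW hγ r).ψ (D.pt 1) T := by
  classical
  subst heqW
  have hne : traceHitTime φ (Φp φ ⁻¹' F) c ≠ ⊤ := by rw [hτ]; exact WithTop.coe_ne_top
  rw [gval, if_neg hne, hτ, WithTop.untopD_coe, pastClassOf_eq_mk_stoppedCurve hγ, futureLawOf_eq hφ hγ]

/-- **`gval` when `F` is never hit.** [folklore] -/
theorem gval_eq_of_traceHitTime_eq_top {c : CurveClass ℂ} (S T : Set (CurveClass ℂ))
    (hτ : traceHitTime φ (Φp φ ⁻¹' F) c = ⊤) :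
    gval κ φ F S T c = S.indicator (fun _ ↦ (1 : ℝ≥0∞)) c *
      T.indicator (fun _ ↦ (1 : ℝ≥0∞)) (CurveClass.mk (Curve.const (D.pt 1))) := by
  classical
  rw [gval, if_pos hτ]

/-- The read-off future law is a probability measure. [folklore] -/
theorem isProbabilityMeasure_futureLawOf (h0 : HasSLETrace κ) (c : CurveClass ℂ) (r : ℝ≥0) :
    IsProbabilityMeasure (futureLawOf κ φ c r) := by
  haveI := isProbabilityMeasure_preWienerMeasure'
  have hψm : Measurable (psiTilde (Φp φ) (drivingPathClass φ c) r) := by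
    have h : Measurable fun p : (C(ℝ≥0, ℝ) × ℝ≥0) × ℂ ↦ psiTilde (Φp φ) p.1.1 p.1.2 p.2 :=
      measurable_psiTilde (continuous_Φp φ).measurable
    exact (h.comp ((measurable_const (a := (drivingPathClass φ c, r))).prodMk measurable_id) :)
  have hf : AEMeasurable (fun ω ↦ compactifiedClass (psiTilde (Φp φ) (drivingPathClass φ c) r)
      (D.pt 1) (sleTrace κ ω)) Process.preWienerMeasure :=
    (measurable_compactifiedClass hψm _).comp_aemeasurable (aemeasurable_sleTrace_pi h0)
  unfold futureLawOf sleImageLaw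
  exact Measure.isProbabilityMeasure_map hf

/-- `gval ≤ 1`. [folklore] -/
theorem gval_le_one (h0 : HasSLETrace κ) (F : Set ℂ) (S T : Set (CurveClass ℂ)) (c : CurveClass ℂ) :
    gval κ φ F S T c ≤ 1 := by
  classical
  have hind : ∀ (X : Set (CurveClass ℂ)) (y : CurveClass ℂ), X.indicator (fun _ ↦ (1 : ℝ≥0∞)) y ≤ 1 :=
    fun X y ↦ by rw [indicator_apply]; split_ifs <;> simp
  unfold gval
  split_ifs with h
  · exact mul_le_one' (hind _ _) (hind _ _)
  · haveI := isProbabilityMeasure_futureLawOf (φ := φ) (κ := κ) h0 c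
      ((traceHitTime φ (Φp φ ⁻¹' F) c).untopD 0)
    exact mul_le_one' (hind _ _) prob_le_one

/-! #### The good event of the canonical space -/

include hφ in
/-- **What a described sample gives**: generation, the driving function, the hitting time as the
read-off hitting time, and the compactified image. [folklore] -/
theorem markov_goodSpec {Γ : (ℝ≥0 → ℝ) → CurveClass ℂ} {ω : ℝ≥0 → ℝ}
    (h : IsLoewnerDescribed φ (Γ ω) (sleDriving κ ω)) (A : Set ℂ) :
    Loewner.IsGeneratedByCurve (sleDriving κ ω) (sleTrace κ ω) ∧
      drivingFunction φ (Γ ω) = sleDriving κ ω ∧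
      hittingAfter (fun t ω ↦ sleTrace κ ω t) A 0 ω = traceHitTime φ A (Γ ω) ∧
      (∀ s, Loewner.trace (drivingFunction φ (Γ ω)) s = sleTrace κ ω s) ∧
      ∃ c' : Curve ℂ, Γ ω = CurveClass.mk c' ∧
        IsCompactifiedImage φ.boundaryExtension (sleTrace κ ω) (D.pt 1) c' := by
  have h' := h
  obtain ⟨hWc, γ₀, hγ₀, c', hc', himg⟩ := h
  have hγ₀eq : γ₀ = sleTrace κ ω := (Loewner.IsGeneratedByCurve.trace_eq_holds hWc hγ₀).symm
  rw [hγ₀eq] at hγ₀ himg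
  have heqW : drivingFunction φ (Γ ω) = sleDriving κ ω :=
    IsLoewnerDescribed.drivingFunction_eq IsLoewnerDescribed.driving_unique_holds hφ h'
  have htrace : ∀ s, Loewner.trace (drivingFunction φ (Γ ω)) s = sleTrace κ ω s := fun s ↦ by
    rw [heqW]; rfl
  refine ⟨hγ₀, heqW, ?_, htrace, c', hc', himg⟩
  exact hittingAfter_eq_of_path_eq (u := fun t ω ↦ sleTrace κ ω t)
    (v := fun t (c : CurveClass ℂ) ↦ Loewner.trace (drivingFunction φ c) t) (fun t ↦ (htrace t).symm) A

end MarkovIdentify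

end Literature.Probability.RandomPlanarGeometry

end
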